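import Mathlib
import HarnessLib
import Literature.Analysis.FluidPDE.VectorCalculus
import Summits.NavierStokesRegularity.NavierStokesRegularity.Theorems.UnthreadedDoorLevelSetLocalLaw

/-!
# Route `UnthreadedDoor` / `ThreadingFlux`, crux `PoloidalLiouville` (stmt-NavierStokesRegularity-1222): Theorems-side twin of the
# antidynamo v2 skeleton's stub Prop `StubLevelSetLocalLaw` (2a′), so the registered stub is closed BY NAME

Definition file (Theorems-side twin; seat ns-wall-eng-7 g5, cell ns-wall-extremal).  The planner's skeleton
`PoloidalLiouville_antidynamo_birth_v2.lean` (ns-idea-6 g5, sha16 4ebf5683127b) lives in the planner's HOME and is not importable from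
`Theorems/`; its stub (2a′) was proved with the body restated (`PoloidalLiouville.stub_levelSetLocalLaw`, p686648).  Here the Prop is
twinned VERBATIM (skeleton l.143) in the skeleton's sub-namespace name `Antidynamo`, and the stub is closed under the skeleton's exact
header `theorem stub_levelSetLocalLaw : StubLevelSetLocalLaw`.

HONEST LABEL: bookkeeping; plan-only stub (2a′), not used by the composition `PoloidalLiouville_of`; the wall `stub_scalarLiouville`,
`PoloidalLiouville` (1222) and NS regularity remain OPEN.
-/

noncomputable section

-- the summit and its single sub-problem share the name (CONVENTIONS §1)
set_option linter.dupNamespace false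

namespace Summit.NavierStokesRegularity.NavierStokesRegularity.Theorems.PoloidalLiouville.Antidynamo

/-- STUB (2a′) statement of the antidynamo v2 skeleton (planner ns-idea-6 g5), the LEVEL-SET-LOCAL REACTION LAW — twin, body VERBATIM
(skeleton l.143): off the critical set the loop first integral `det[x − x₀, ∇m, ∇T] = 0` makes `m` locally a smooth function of
`(T, ‖x − x₀‖)`. -/
def StubLevelSetLocalLaw : Prop :=
  ∀ (T m : EuclideanSpace ℝ (Fin 3) → ℝ) (x₀ x₁ : EuclideanSpace ℝ (Fin 3)) (U : Set (EuclideanSpace ℝ (Fin 3))),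
    IsOpen U → x₁ ∈ U → x₁ ≠ x₀ → ContDiffOn ℝ (⊤ : ℕ∞) T U → ContDiffOn ℝ (⊤ : ℕ∞) m U →
    Literature.Analysis.FluidPDE.cross (gradient T x₁) (x₁ - x₀) ≠ 0 →
    (∀ x ∈ U, inner ℝ (x - x₀) (Literature.Analysis.FluidPDE.cross (gradient m x) (gradient T x)) = 0) →
    ∃ V : Set (EuclideanSpace ℝ (Fin 3)), IsOpen V ∧ x₁ ∈ V ∧ V ⊆ U ∧
      ∃ M : ℝ → ℝ → ℝ, ContDiff ℝ (⊤ : ℕ∞) (Function.uncurry M) ∧ ∀ x ∈ V, m x = M (T x) ‖x - x₀‖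


/-- ★ The registered stub (2a′) BY NAME: `stub_levelSetLocalLaw : StubLevelSetLocalLaw` (kernel proof `PoloidalLiouville.stub_levelSetLocalLaw`,
p686648, `UnthreadedDoorLevelSetLocalLaw.lean`). -/
theorem stub_levelSetLocalLaw : StubLevelSetLocalLaw :=
  PoloidalLiouville.stub_levelSetLocalLaw

end Summit.NavierStokesRegularity.NavierStokesRegularity.Theorems.PoloidalLiouville.Antidynamo

end
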